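import Summits.BirchSwinnertonDyer.Rank1Residual.ManinAdditive.DegeneracyClassEulerUnitTwist
import HarnessLib
import HarnessLib.Audit.Tags

/-!
# LEMMA C (es g22, PROVED): the CONVERSE of THEOREM U♮E — a unit twist of PRIME conductor `ℓ ≡ 2 (mod 3)` with its
# Euler factor forces an E-translated prime-class degeneracy loop of plus coordinate prime to `3`; hence the plus
# hypothesis (K_t)♮E at `f` is EQUIVALENT to such a twist (cell `bsd-f2-manin`, T-es-29 (i′), typer g15)

Cell `bsd-f2-manin` (D-0131 (3) frontier), lens es, planner es g22 MEMO-es §36.16 («PROVED (5)» 2026-08-28T21:00:47Z); landed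
by the cell typer g15 VERBATIM from HOME/es/Sketch-es-g22-thm87.lean sha16 1fa952104aa82908 §LemmaC (file lines 1880–2168):
`loopCoeff` (the two weighted character sums of `loopWeight t u`, `loopCoeff_eq_sums`), FIRST ORTHOGONALITY
`sum_char_mul_char_inv : Σ_x χ(x)·χ'(x⁻¹) = φ(ℓ)·[χ = χ']` at prime `ℓ`, FOURIER INVERSION over residues
`fourier_inversion_loopCoeff`, the Euler–Fourier identity `euler_fourier_identity`, **LEMMA C**
`degeneracyClassEulerList_of_primeUnitTwist` (prime `ℓ ≡ 2 (mod 3)`, `ℓ ∤ tN`, `ℓ ∤ q (q ∈ L)`, `χ` even, `3 ∤ ord χ`,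
`χ(t̄) ≠ 1`, `E_L(χ)·S_χ/Ω⁺_f` a unit above `3` ⟹ `DegeneracyClassEulerListPlusIndexPrimeTo f 3 t L a`; elementary unit trick
`(1 − ζ)·(Σ_{k<n} Σ_{i<k} ζ^i) = n = ord χ`) and the **EQUIVALENCE** `degeneracyClassEulerList_iff_primeUnitTwist` (f-level,
any ratio `t`, any list `L`, any `a`; the forward half is THEOREM U♮E_L of `DegeneracyClassEulerUnitTwist`).  Namespace
`BsdF2ManinEsG22T` ↦ `…ManinAdditive.KatoCurve`; one undocumented lemma (`loopCoeff_eq_sums`) received a one-line docstring.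
The W-level form (the law E-es-93 at `D.f` ⟺ `PrimeThreeAdicPolarWitness W D.f`) is the sibling
`DegeneracyClassEulerPrimeWitness.lean`.

EVERYTHING HERE IS A SORRY-FREE THEOREM (no law, no fact).  USE: CENSUS E43's 4305/4313 certified rows (es, leaf header of
`DegeneracyClassEulerLaws`) are thereby kernel-checked instances of the CONCLUSION of E-es-93 modulo the `polar.gp` numerics
of the recorded `(m, χ)`.  BC7 n/a (theorems).  REF1 R-es-44 scope (§C) PENDING at filing — a finding is repaired under a NEW
name (append-only).  bears_on: stmt-BirchSwinnertonDyer-22968.  PARTITION 0 · beyond-print theorem: es says YES (lemma-level;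
finite Fourier analysis on `(ℤ/ℓ)ˣ`, nearest print Stevens 1985 / Ash–Stevens 1986 per es MEMO-es §36.8) · BSD is not proved by
this; Manin's conjecture is not proved by this.
-/

noncomputable section

open scoped Classical MatrixGroups ModularForm ComplexConjugate

open CongruenceSubgroup Complex Literature.NumberTheory.EllipticCurves
  Literature.NumberTheory.EllipticCurves.ModularForms
open Summit.BirchSwinnertonDyer.Rank1Residual.ManinAdditive.KatoCurve
open Summit.BirchSwinnertonDyer.Rank1Residual.ManinAdditive.Gamma1Lattice

namespace Summit.BirchSwinnertonDyer.Rank1Residual.ManinAdditive.KatoCurve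

section LemmaC

/-! ## §C LEMMA C (es g22): the CONVERSE — a polar unit twist of prime conductor `m ≡ 2 (mod 3)` forces an
E-translated prime-class loop with plus coordinate prime to `3`.  With THEOREM U♮E this makes the law
(K_t)♮E at `f` EQUIVALENT to the existence of such a twist. -/

variable {N : ℕ} (f : CuspForm (Gamma0 N) 2)

/-- The loop coefficient `c_u(χ) = χ((t̄u)⁻¹) + χ((−t̄u)⁻¹) − χ(u⁻¹) − χ((−u)⁻¹)`. -/
def loopCoeff {ℓ : ℕ} (t : ℕ) (u : ZMod ℓ) (χ : DirichletCharacter ℂ ℓ) : ℂ :=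
  χ ((t : ZMod ℓ) * u)⁻¹ + χ (-((t : ZMod ℓ) * u))⁻¹ - χ u⁻¹ - χ (-u)⁻¹

/-- `loopCoeff` is the difference of the two weighted character sums of `loopWeight t u` (es g22, PROVED). -/
theorem loopCoeff_eq_sums {ℓ : ℕ} [NeZero ℓ] (t : ℕ) (u : ZMod ℓ) (χ : DirichletCharacter ℂ ℓ) :
    loopCoeff t u χ = (∑ x : ZMod ℓ, ((loopWeight t u x : ℤ) : ℂ) * χ x⁻¹)
      + ∑ x : ZMod ℓ, ((loopWeight t u x : ℤ) : ℂ) * χ (-x)⁻¹ := by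
  rw [sum_loopWeight_mul t u (fun x => χ x⁻¹), sum_loopWeight_mul t u (fun x => χ (-x)⁻¹)]
  simp only [loopCoeff]
  ring

/-- First orthogonality relation (sum over residues). -/
theorem sum_char_mul_char_inv {ℓ : ℕ} [Fact ℓ.Prime] [NeZero ℓ] (χ χ' : DirichletCharacter ℂ ℓ) :
    ∑ u : ZMod ℓ, χ u * χ' u⁻¹ = if χ = χ' then (ℓ.totient : ℂ) else 0 := by
  have h : ∀ u : ZMod ℓ, χ u * χ' u⁻¹ = (χ * χ'⁻¹) u := by
    intro u; rw [MulChar.mul_apply, MulChar.inv_apply']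
  simp_rw [h]
  split_ifs with hχ
  · subst hχ
    rw [mul_inv_cancel, MulChar.sum_one_eq_card_units, ZMod.card_units_eq_totient]
  · exact MulChar.sum_eq_zero_of_ne_one (fun h1 => hχ (mul_inv_eq_one.mp h1))

/-- Fourier inversion of the loop coefficients against an even character. -/
theorem fourier_inversion_loopCoeff {ℓ : ℕ} [Fact ℓ.Prime] [NeZero ℓ] (t : ℕ)
    (χ : DirichletCharacter ℂ ℓ) (hev : χ.Even) (T : DirichletCharacter ℂ ℓ → ℂ) :
    ∑ u : ZMod ℓ, χ u * (∑ χ' : DirichletCharacter ℂ ℓ, loopCoeff t u χ' * T χ')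
      = (ℓ.totient : ℂ) * (2 * (χ (t : ZMod ℓ)⁻¹ - 1)) * T χ := by
  have h1 : χ (-1) = 1 := hev
  have hI : ∀ χ' : DirichletCharacter ℂ ℓ, ∑ u : ZMod ℓ, χ u * loopCoeff t u χ'
      = (χ' (t : ZMod ℓ)⁻¹ + χ' (-(t : ZMod ℓ))⁻¹ - 1 - χ' (-1)⁻¹)
          * (if χ = χ' then (ℓ.totient : ℂ) else 0) := by
    intro χ'
    rw [← sum_char_mul_char_inv χ χ', Finset.mul_sum]
    refine Finset.sum_congr rfl (fun u _ => ?_)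
    have e1 : χ' ((t : ZMod ℓ) * u)⁻¹ = χ' (t : ZMod ℓ)⁻¹ * χ' u⁻¹ := by rw [mul_inv, map_mul]
    have e2 : χ' (-((t : ZMod ℓ) * u))⁻¹ = χ' (-(t : ZMod ℓ))⁻¹ * χ' u⁻¹ := by
      rw [← neg_mul, mul_inv, map_mul]
    have e4 : χ' (-u)⁻¹ = χ' (-1)⁻¹ * χ' u⁻¹ := by rw [← map_mul, ← mul_inv, neg_one_mul]
    simp only [loopCoeff]
    rw [e1, e2, e4]
    ring
  calc ∑ u : ZMod ℓ, χ u * (∑ χ' : DirichletCharacter ℂ ℓ, loopCoeff t u χ' * T χ')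
      = ∑ χ' : DirichletCharacter ℂ ℓ, (∑ u : ZMod ℓ, χ u * loopCoeff t u χ') * T χ' := by
        simp_rw [Finset.mul_sum]
        rw [Finset.sum_comm]
        refine Finset.sum_congr rfl (fun χ' _ => ?_)
        rw [Finset.sum_mul]
        refine Finset.sum_congr rfl (fun u _ => ?_)
        ring
    _ = ∑ χ' : DirichletCharacter ℂ ℓ,
          (if χ = χ' then (χ' (t : ZMod ℓ)⁻¹ + χ' (-(t : ZMod ℓ))⁻¹ - 1 - χ' (-1)⁻¹)
            * (ℓ.totient : ℂ) * T χ' else 0) := by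
        refine Finset.sum_congr rfl (fun χ' _ => ?_)
        rw [hI χ']
        split_ifs <;> ring
    _ = (χ (t : ZMod ℓ)⁻¹ + χ (-(t : ZMod ℓ))⁻¹ - 1 - χ (-1)⁻¹) * (ℓ.totient : ℂ) * T χ := by
        rw [Finset.sum_ite_eq]; simp
    _ = (ℓ.totient : ℂ) * (2 * (χ (t : ZMod ℓ)⁻¹ - 1)) * T χ := by
        have e5' : (-(t : ZMod ℓ))⁻¹ = -1 * (t : ZMod ℓ)⁻¹ := by rw [neg_one_mul, neg_inv]
        have e5 : χ (-(t : ZMod ℓ))⁻¹ = χ (t : ZMod ℓ)⁻¹ := by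
          rw [e5', map_mul, h1, one_mul]
        have e6 : χ (-1)⁻¹ = 1 := by rw [inv_neg_one, h1]
        rw [e5, e6]
        ring

/-- The Fourier identity WITH the Euler factor, for an arbitrary unit `u`:
`Σ_χ c_u(χ)·E_F(χ)·S_χ = φ(m)·(z_u + z̄_u)`, `z_u = Σ_x (θ_F w_{t,u})(x)·{∞, x/m}`. -/
theorem euler_fourier_identity [NeZero N] (hreal : ∀ n, (cuspCoeff f n).im = 0) (t : ℕ) (L : List ℕ)
    (a : ℕ → ℤ) {ℓ : ℕ} [Fact ℓ.Prime] [NeZero ℓ] (hLne : ∀ q ∈ L, ((q : ℕ) : ZMod ℓ) ≠ 0)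
    (ht0 : ((t : ℕ) : ZMod ℓ) ≠ 0) {u : ZMod ℓ} (hu0 : u ≠ 0) :
    ∑ χ : DirichletCharacter ℂ ℓ, loopCoeff t u χ * (eulerFactorList a L χ * twistedSymbolSum f χ)
      = (ℓ.totient : ℂ) *
        ((∑ x : ZMod ℓ, ((eulerShiftList a L (loopWeight t u) x : ℤ) : ℂ) * cuspValue f ℓ x)
          + conj (∑ x : ZMod ℓ, ((eulerShiftList a L (loopWeight t u) x : ℤ) : ℂ) * cuspValue f ℓ x)) := by
  have hu'0 : (t : ZMod ℓ) * u ≠ 0 := mul_ne_zero ht0 hu0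
  set w : ZMod ℓ → ℤ := loopWeight t u with hwdef
  set θw : ZMod ℓ → ℤ := eulerShiftList a L w with hθwdef
  have hw0 : w 0 = 0 := loopWeight_apply_zero t hu0 hu'0
  have hθw0 : θw 0 = 0 := eulerShiftList_apply_zero a L w hw0
  set z : ℂ := ∑ x : ZMod ℓ, (θw x : ℂ) * cuspValue f ℓ x with hzdef
  have t1 : ∑ χ : DirichletCharacter ℂ ℓ,
      (∑ x : ZMod ℓ, (w x : ℂ) * χ x⁻¹) * (eulerFactorList a L χ * twistedSymbolSum f χ)
      = (ℓ.totient : ℂ) * z := by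
    have : ∀ χ : DirichletCharacter ℂ ℓ,
        (∑ x : ZMod ℓ, (w x : ℂ) * χ x⁻¹) * (eulerFactorList a L χ * twistedSymbolSum f χ)
          = (∑ x : ZMod ℓ, (θw x : ℂ) * χ x⁻¹) * twistedSymbolSum f χ := by
      intro χ
      rw [← mul_assoc, weightChar_mul_eulerFactorList a χ L w hLne]
    simp_rw [this]
    exact sum_weightChar_mul_twistedSymbolSum f θw hθw0
  have t2 : ∑ χ : DirichletCharacter ℂ ℓ,
      (∑ x : ZMod ℓ, (w x : ℂ) * χ (-x)⁻¹) * (eulerFactorList a L χ * twistedSymbolSum f χ)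
      = (ℓ.totient : ℂ) * conj z := by
    have hneg : ∀ χ : DirichletCharacter ℂ ℓ,
        ∑ x : ZMod ℓ, (w x : ℂ) * χ (-x)⁻¹ = ∑ y : ZMod ℓ, ((w (-y) : ℤ) : ℂ) * χ y⁻¹ := by
      intro χ
      rw [← sum_reindex_neg (fun x => (w x : ℂ) * χ (-x)⁻¹)]
      refine Finset.sum_congr rfl (fun y _ => ?_)
      simp only [neg_neg]
    have hcomm : ∀ χ : DirichletCharacter ℂ ℓ,
        ∑ x : ZMod ℓ, ((eulerShiftList a L (fun y => w (-y)) x : ℤ) : ℂ) * χ x⁻¹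
          = ∑ x : ZMod ℓ, ((θw (-x) : ℤ) : ℂ) * χ x⁻¹ := by
      intro χ
      refine Finset.sum_congr rfl (fun x _ => ?_)
      rw [eulerShiftList_neg a L w x]
    have : ∀ χ : DirichletCharacter ℂ ℓ,
        (∑ x : ZMod ℓ, (w x : ℂ) * χ (-x)⁻¹) * (eulerFactorList a L χ * twistedSymbolSum f χ)
          = (∑ x : ZMod ℓ, ((θw (-x) : ℤ) : ℂ) * χ x⁻¹) * twistedSymbolSum f χ := by
      intro χ
      rw [← mul_assoc, hneg χ, weightChar_mul_eulerFactorList a χ L _ hLne, hcomm χ]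
    simp_rw [this]
    rw [sum_weightChar_mul_twistedSymbolSum f (fun x => θw (-x)) (by simpa using hθw0)]
    congr 1
    rw [← sum_reindex_neg (fun x => ((θw (-x) : ℤ) : ℂ) * cuspValue f ℓ x)]
    simp only [neg_neg]
    rw [hzdef, map_sum]
    refine Finset.sum_congr rfl (fun y _ => ?_)
    rw [map_mul, map_intCast, cuspValue_neg f hreal]
  simp_rw [loopCoeff_eq_sums, add_mul, Finset.sum_add_distrib]
  rw [t1, t2, ← mul_add]

/-- **LEMMA C (es g22; PROVED).**  A unit twist `E_F(χ)·S_χ/Ω⁺_f` (`min_{𝔭∣3} v_𝔭 = 0`) by an even character of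
PRIME conductor `ℓ ≡ 2 (mod 3)`, `ℓ ∤ tN`, `ℓ ∤ q ∈ F`, with `3 ∤ ord χ` and `χ(t̄) ≠ 1`, forces the E-translated
prime-class loops of ratio `t` to have plus index prime to `3`. -/
theorem degeneracyClassEulerList_of_primeUnitTwist [NeZero N] (t : ℕ) (L : List ℕ) (a : ℕ → ℤ)
    (hf : IsNewform0 f) (hQ : coeffField f = ⊥) {ℓ : ℕ} [Fact ℓ.Prime] [NeZero ℓ]
    (hℓ3 : ℓ % 3 = 2) (hℓtN : ¬ ℓ ∣ t * N) (hℓL : ∀ q ∈ L, ¬ ℓ ∣ q)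
    {χ : DirichletCharacter ℂ ℓ} (hev : χ.Even) (hord : ¬ 3 ∣ orderOf χ) (hχt : χ (t : ZMod ℓ) ≠ 1)
    (hunit : ∀ s : ℕ, ¬ 3 ∣ s → ¬ _root_.IsIntegral ℤ
      ((s : ℂ) * (eulerFactorList a L χ * twistedSymbolSum f χ / (plusPeriod f : ℂ)) / 3)) :
    DegeneracyClassEulerListPlusIndexPrimeTo f 3 t L a := by
  have hℓp : ℓ.Prime := Fact.out
  have hΩpos : 0 < plusPeriod f := IsNewform0.plusPeriod_pos_holds hf hQ
  have hΩ : plusPeriod f ≠ 0 := hΩpos.ne'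
  have hΩC : (plusPeriod f : ℂ) ≠ 0 := by exact_mod_cast hΩ
  obtain ⟨hre, -⟩ := realPeriods_eq_zmultiples_of_plusPeriod_ne_zero f hΩ
  have hreal : ∀ n, (cuspCoeff f n).im = 0 := cuspCoeff_im_eq_zero_of_coeffField_eq_bot hQ
  have hℓN : ¬ ℓ ∣ N := fun h => hℓtN (Dvd.dvd.mul_left h t)
  have hℓt : ¬ ℓ ∣ t := fun h => hℓtN (Dvd.dvd.mul_right h N)
  have hℓN' : ℓ.Coprime N := (Nat.Prime.coprime_iff_not_dvd hℓp).mpr hℓN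
  have hut : IsUnit ((t : ℕ) : ZMod ℓ) :=
    (ZMod.isUnit_iff_coprime t ℓ).mpr ((Nat.Prime.coprime_iff_not_dvd hℓp).mpr hℓt).symm
  have ht0 : ((t : ℕ) : ZMod ℓ) ≠ 0 := hut.ne_zero
  have hLne : ∀ q ∈ L, ((q : ℕ) : ZMod ℓ) ≠ 0 :=
    fun q hq h => hℓL q hq ((ZMod.natCast_eq_zero_iff q ℓ).mp h)
  have hφ : (ℓ.totient : ℂ) ≠ 0 := by exact_mod_cast (Nat.totient_pos.mpr hℓp.pos).ne'
  have hint : ∀ n : ℤ, IsIntegral ℤ ((n : ℤ) : ℂ) := fun n => by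
    simpa using (isIntegral_algebraMap (R := ℤ) (A := ℂ) (x := n))
  -- the E-translated loops as a function of the residue `u`
  set zf : ZMod ℓ → ℂ :=
    fun u => ∑ x : ZMod ℓ, ((eulerShiftList a L (loopWeight t u) x : ℤ) : ℂ) * cuspValue f ℓ x with hzfdef
  have hzΛ : ∀ u : ZMod ℓ, zf u ∈ periodLattice f := by
    intro u
    refine weightSum_mem_periodLattice f hℓp hℓN' _ (sum_eulerShiftList_eq_zero a L _ hLne ?_)
    simpa using sum_loopWeight_mul t u (fun _ => (1 : ℂ))
  set T : DirichletCharacter ℂ ℓ → ℂ := fun χ' => eulerFactorList a L χ' * twistedSymbolSum f χ' with hTdef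
  -- KEY: some unit `u` has plus coordinate prime to `3`
  have hkey : ∃ u : ZMod ℓ, u ≠ 0 ∧ ∃ k : ℤ, ¬ (3 : ℤ) ∣ k ∧ zf u + conj (zf u) = (k : ℂ) * (plusPeriod f : ℂ) := by
    by_contra hcon
    push Not at hcon
    have h3 : ∀ u : ZMod ℓ, u ≠ 0 → ∃ k' : ℤ, zf u + conj (zf u) = 3 * (k' : ℂ) * (plusPeriod f : ℂ) := by
      intro u hu
      obtain ⟨k, hk⟩ := exists_add_conj_eq_int_mul f hre (hzΛ u)
      have h3k : (3 : ℤ) ∣ k := by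
        by_contra h
        exact hcon u hu k h hk
      obtain ⟨k', rfl⟩ := h3k
      exact ⟨k', by rw [hk]; push_cast; ring⟩
    choose! k' hk' using h3
    have hId : ∀ u : ZMod ℓ, u ≠ 0 →
        ∑ χ' : DirichletCharacter ℂ ℓ, loopCoeff t u χ' * T χ'
          = (ℓ.totient : ℂ) * (3 * (k' u : ℂ) * (plusPeriod f : ℂ)) := by
      intro u hu
      rw [← hk' u hu]
      exact euler_fourier_identity f hreal t L a hLne ht0 hu
    have hsum : ∑ u : ZMod ℓ, χ u * (∑ χ' : DirichletCharacter ℂ ℓ, loopCoeff t u χ' * T χ')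
        = ∑ u : ZMod ℓ, χ u * ((ℓ.totient : ℂ) * (3 * (k' u : ℂ) * (plusPeriod f : ℂ))) := by
      refine Finset.sum_congr rfl (fun u _ => ?_)
      by_cases hu : u = 0
      · subst hu
        rw [χ.map_nonunit not_isUnit_zero, zero_mul, zero_mul]
      · rw [hId u hu]
    rw [fourier_inversion_loopCoeff t χ hev T] at hsum
    have h2 : ∑ u : ZMod ℓ, χ u * ((ℓ.totient : ℂ) * (3 * (k' u : ℂ) * (plusPeriod f : ℂ)))
        = (ℓ.totient : ℂ) * (3 * (plusPeriod f : ℂ)) * ∑ u : ZMod ℓ, χ u * (k' u : ℂ) := by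
      rw [Finset.mul_sum]
      refine Finset.sum_congr rfl (fun u _ => ?_)
      ring
    rw [h2] at hsum
    -- the root of unity `ζ = χ(t̄⁻¹) ≠ 1` of order prime to `3`
    set ζ : ℂ := χ (t : ZMod ℓ)⁻¹ with hζdef
    have hsum' : 2 * (ζ - 1) * T χ
        = 3 * (plusPeriod f : ℂ) * ∑ u : ZMod ℓ, χ u * (k' u : ℂ) := by
      apply mul_left_cancel₀ hφ
      linear_combination hsum
    -- integrality of `2(ζ − 1)·R/3`
    have hJ : IsIntegral ℤ (2 * (ζ - 1) * (T χ / (plusPeriod f : ℂ)) / 3) := by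
      have : 2 * (ζ - 1) * (T χ / (plusPeriod f : ℂ)) / 3
          = ∑ u : ZMod ℓ, χ u * (k' u : ℂ) := by
        have h3 : (3 : ℂ) ≠ 0 := by norm_num
        field_simp
        linear_combination hsum'
      rw [this]
      exact IsIntegral.sum _ (fun u _ => (isIntegral_apply χ u).mul (hint (k' u)))
    have hn0 : orderOf χ ≠ 0 := (orderOf_pos χ).ne'
    have hζn : ζ ^ orderOf χ = 1 := by
      rw [hζdef, ← MulChar.pow_apply' χ hn0, pow_orderOf_eq_one,
        MulChar.one_apply (isUnit_iff_ne_zero.mpr (inv_ne_zero ht0))]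
    have hζ1 : ζ ≠ 1 := by
      intro h
      apply hχt
      have hm := map_mul χ ((t : ZMod ℓ)⁻¹) (t : ZMod ℓ)
      rw [inv_mul_cancel₀ ht0, map_one, ← hζdef, h, one_mul] at hm
      exact hm.symm
    set y : ℂ := ∑ k ∈ Finset.range (orderOf χ), ∑ i ∈ Finset.range k, ζ ^ i with hydef
    have hy : (1 - ζ) * y = (orderOf χ : ℂ) := by
      rw [hydef, Finset.mul_sum]
      simp_rw [mul_neg_geom_sum]
      rw [Finset.sum_sub_distrib, Finset.sum_const, Finset.card_range, nsmul_eq_mul, mul_one,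
        geom_sum_eq hζ1, hζn, sub_self, zero_div, sub_zero]
    have hyI : IsIntegral ℤ y :=
      IsIntegral.sum _ (fun k _ => IsIntegral.sum _ (fun i _ => (isIntegral_apply χ _).pow i))
    have hfinal : IsIntegral ℤ (((2 * orderOf χ : ℕ) : ℂ) * (T χ / (plusPeriod f : ℂ)) / 3) := by
      have : ((2 * orderOf χ : ℕ) : ℂ) * (T χ / (plusPeriod f : ℂ)) / 3
          = -y * (2 * (ζ - 1) * (T χ / (plusPeriod f : ℂ)) / 3) := by
        rw [show ((2 * orderOf χ : ℕ) : ℂ) = 2 * ((1 - ζ) * y) by rw [hy]; push_cast; ring]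
        ring
      rw [this]
      exact hyI.neg.mul hJ
    refine hunit (2 * orderOf χ) ?_ hfinal
    intro h
    rcases (Nat.Prime.dvd_mul Nat.prime_three).mp h with h | h
    · omega
    · exact hord h
  -- conclusion from the key unit
  obtain ⟨u, hu0, k, hk3, hk⟩ := hkey
  have hzS : zf u ∈ degeneracyLoopsClassTwoEulerList f t L a := by
    refine ⟨ℓ, u.val, inferInstance, hℓp, hℓ3, hℓtN, hℓL, ?_, ?_⟩
    · intro h
      have hlt : u.val < ℓ := ZMod.val_lt u
      have hv0 : u.val ≠ 0 := fun h0 => hu0 ((ZMod.val_eq_zero u).mp h0)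
      exact hv0 (Nat.eq_zero_of_dvd_of_lt h hlt)
    · rw [ZMod.natCast_zmod_val]
  intro x hx
  obtain ⟨j, hj⟩ := exists_add_conj_eq_int_mul f hre hx
  refine ⟨((j * k : ℤ) : ℂ) * zf u, ?_, k.natAbs ^ 2, ?_, ?_⟩
  · rw [← zsmul_eq_mul]
    exact AddSubgroup.zsmul_mem _ (AddSubgroup.subset_closure hzS) _
  · intro h
    exact hk3 (Int.natCast_dvd.mpr (Nat.prime_three.dvd_of_dvd_pow h))
  · have hk2 : ((k.natAbs ^ 2 : ℕ) : ℂ) = (k : ℂ) ^ 2 := by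
      have h' : (((k.natAbs : ℤ) ^ 2 : ℤ) : ℂ) = ((k ^ 2 : ℤ) : ℂ) :=
        congrArg (fun z : ℤ => (z : ℂ)) (Int.natAbs_sq k)
      push_cast at h'
      rw [Nat.cast_pow]
      simpa using h'
    have hx' : x + starRingEnd ℂ x = (j : ℂ) * (plusPeriod f : ℂ) := hj
    rw [hk2, hx', map_mul, map_intCast, ← mul_add, hk]
    push_cast
    ring

/-- **THE EQUIVALENCE (es g22; PROVED).**  For a rational newform, the E-translated prime-class plus hypothesis
of ratio `t` ⟺ a polar unit twist (Euler factor included) by an even character of PRIME conductor `ℓ ≡ 2 (3)`,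
`ℓ ∤ tN`, `ℓ ∤ q ∈ F`, `3 ∤ ord χ`, `χ(t̄) ≠ 1`. -/
theorem degeneracyClassEulerList_iff_primeUnitTwist [NeZero N] (t : ℕ) (L : List ℕ) (a : ℕ → ℤ)
    (hf : IsNewform0 f) (hQ : coeffField f = ⊥) :
    DegeneracyClassEulerListPlusIndexPrimeTo f 3 t L a ↔
      ∃ (ℓ : ℕ) (_ : NeZero ℓ), ℓ.Prime ∧ ℓ % 3 = 2 ∧ ¬ ℓ ∣ t * N ∧ (∀ q ∈ L, ¬ ℓ ∣ q) ∧
        ∃ χ : DirichletCharacter ℂ ℓ, χ.Even ∧ ¬ 3 ∣ orderOf χ ∧ χ (t : ZMod ℓ) ≠ 1 ∧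
          ∀ s : ℕ, ¬ 3 ∣ s → ¬ _root_.IsIntegral ℤ
            ((s : ℂ) * (eulerFactorList a L χ * twistedSymbolSum f χ / (plusPeriod f : ℂ)) / 3) := by
  constructor
  · intro hd
    obtain ⟨ℓ, hℓ, hℓp, hℓ3, hℓtN, hℓL, χ, r, -, -, -, hord, hχt, hev, hr, hu⟩ :=
      exists_prime_eulerListUnitTwist_of_degeneracyClass f t L a hf hQ hd
    have hΩC : (plusPeriod f : ℂ) ≠ 0 := by
      exact_mod_cast (IsNewform0.plusPeriod_pos_holds hf hQ).ne'
    refine ⟨ℓ, hℓ, hℓp, hℓ3, hℓtN, hℓL, χ, hev, hord, hχt, ?_⟩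
    rw [hr, mul_div_cancel_right₀ _ hΩC]
    exact hu
  · rintro ⟨ℓ, hℓ, hℓp, hℓ3, hℓtN, hℓL, χ, hev, hord, hχt, hu⟩
    haveI : Fact ℓ.Prime := ⟨hℓp⟩
    exact degeneracyClassEulerList_of_primeUnitTwist f t L a hf hQ hℓ3 hℓtN hℓL hev hord hχt hu

end LemmaC

end Summit.BirchSwinnertonDyer.Rank1Residual.ManinAdditive.KatoCurve

end
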